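import Literature.MathematicalPhysics.QuantumFieldTheory.Balaban1983to89.B7Prop1Explicit

/-!
# BlockAverageLoopFlux (T⁴ programme, node NE3, crew item (s4b) of the owner skeleton v1.1, PART 1a) — the loop-flux
# formula for the first-order exponent `X̂_c` of Bałaban's block average (42): an explicit signed sum of plaquette
# circulations, evaluated in closed form for a constant flux (the pre-compensation `X₀` WITH ITS SIGN) and bounded
# for a Lipschitz flux

HONEST FRAMING (cell `pub-balaban`, T4-DAG PAGE 1; unit `b2b-balaban-t4-ne3-formalise-leaf-03` = NE3 formalisation
swarm, leaf prover 03; claim CLAIMS.log l.7100).  The cell's T⁴ target is the finite-torus continuum limit of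
gauge-invariant observables — NOT infinite volume, NO mass gap, NOT Clay, NOT summit progress.  Row NE3 (node U1b) is
NOT proved by anything here; its reading (A) is CONDITIONAL on ⟨`MinimalActionRate.SandwichData` /
`MinimalActionRefine.SmoothRefine`⟩ (owner skeleton `t4/b2b-balaban-t4-ne3-p1/SKELETON-NE3-P1.md` v1.1 §3–§4), and this
file imports neither.  It is PURE LATTICE BOOKKEEPING about the linearisation `Xhat`/`Tside` (tree `B7Prop1Explicit`;
the displays before (47) and (47)–(48) p. 25 of T. Bałaban, *Averaging operations for lattice gauge theories*, Commun.
Math. Phys. **98** (1985) 17–51 [Balaban1985Averaging]) of the concrete average (42) p. 23 (tree `bavg`), with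
coefficients in any normed ring — the first-order («abelian») content of the kinematic refinement lemma (skeleton §3
leaf R1, §6 (s4b): «the pre-compensation `X₀`; the sanity case that fixes all signs∕orientations of `X₀`»; R1e «loop-log
prediction»).  No printed sentence is a hypothesis of any declaration; nothing about Bałaban's minimisers is asserted.
Companion: `AbelianBlockAverage` (in a commutative algebra (42) is EXACTLY `exp` of `Tside = Xhat + A(Γ_c)`).
Sibling (β sub-cell vocabulary `Beta.AffineAveraging.Form1`, letter lists): `Beta.AveragingContours` types `Γ_{y,x}`,
`Γ_{c,x}`, the loop (114) and the linear averaging (14) with «axial tails are pure gauge»; it has NO plaquette∕Stokes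
identity (its header: «(48) itself is NOT typed here») — the loop-flux formula below is new, and is stated in the
`B7Prop1Explicit` vocabulary (`asum`, `gammaWord`, `Xhat`) that row NE3's `bavg`-based files consume.

CONTENT (all [folklore] finite-sum bookkeeping, 0 sorry).
§1 `upper n v` (keep the coordinates `≥ n` of `v`), `upper_succ_add`, and the recursion of the tree contour of
   B5 (1.7) / B7 p. 24 (coordinates changed in the order `d−1, …, 0`): `treeWord (upper m v) = treeWord (upper (m+1) v)
   ++ seg m (v m)` (`treeWord_upper_succ`).
§2 THE LOOP-FLUX FORMULA: for the loop `Γ_{c,x} ∪ (−Γ_c)` of (42) (`gammaWord L κ v ++ seg κ (−L)`, `x = c₋ + v`,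
   `v ≥ 0`) and any bond function `A` with values in a normed ring,
   `A(Γ_{c,x} ∪ (−Γ_c)) = Σ_m A(∂R_m)`, `R_m` = the `v_m × L` rectangle in the `(m, κ)`-plane based at
   `c₋ + upper (m+1) v` (`asum_loop_telescope`; the `m = κ` rectangle is degenerate), `= Σ_m Σ_{i<v_m} Σ_{j<L}
   A(∂p)_{c₋ + upper(m+1)v + ie_m + je_κ}(plaqWord m κ)` (`asum_loop_eq_sum_plaq`, by the tree's abelian Stokes formula
   `B7Prop1Explicit.stokes`); hence `Xhat L A q κ = Σ_r L^{−d} Σ_m Σ_{i<r_m} Σ_{j<L} A(∂p)_{…}(plaqWord m κ)`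
   (`Xhat_eq_sum_plaq`).
§3 `X₀` WITH ITS SIGN: `Σ_{r ∈ [0,L)^d} r_m = L^d(L−1)/2` (`sum_boxCoord`, by the reflection `r_m ↦ L−1−r_m`), the
   averaging identity `Σ_r L^{−d} Σ_m Σ_{i<r_m}Σ_{j<L} g_m = (L(L−1)/2)·Σ_m g_m` (`avg_tripleSum_const`), and for
   plaquette circulations constant per plane, `A(∂p)(plaqWord m κ) = f_m` for all base points,
   **`Xhat L A q κ = (L(L−1)/2) • Σ_m f_m`** (`Xhat_of_const_flux`; `f_κ = 0` automatically, `asum_plaqWord_self`;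
   orientation: `plaqWord m κ = [+e_m, +e_κ, −e_m, −e_κ]`, so in the `F_{κν} := A(plaqWord κ ν)` orientation the sign is
   `−`, `asum_plaqWord_swap`).  In coarse units (`F = L²f` per coarse plaquette) this is the skeleton's
   `X₀(z,κ) = −((L−1)/(2L))·Σ_{ν≠κ} F_{κν}(z)` — the first moment of the loop fluxes of (42) over the corner block.
§4 LIPSCHITZ FLUX: if `‖A(∂p)_{p}(m κ) − A(∂p)_{q}(m κ)‖ ≤ δ·|p − q|₁` within `|p − q|₁ ≤ (d+2)L`, then
   `‖Xhat L A q κ − (L(L−1)/2) • Σ_m A(∂p)_q(plaqWord m κ)‖ ≤ (d(d+2)/2)·L³·δ` (`norm_Xhat_sub_const_flux_le`) — the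
   abelian «loop-log prediction» of skeleton §3 R1e.
What is NOT here: the abelian exponential (companion file), the refinement construction itself (fine `W` from coarse
`U`; PART 2 of (s4b)), anything non-abelian (leaves R1a–R1e, R2 of the skeleton: other seats), anything about
minimisers.  PLACEMENT: `Summits/QuantumFields/BalabanUV/` (human rule 2026-08-19: our lemmas, not a published
statement).  Record: HOME `t4/b2b-balaban-t4-ne3-formalise-leaf-03/`.
HONEST DEPENDENCY (cell, verbatim): continuum YM on T⁴ ⇐ BetaPertH ∧ nine spine estimates (0/9 proved); BetaPertH ⇐
(D1) ∧ (D4) ∧ CAP+tail; G-an2-4 gates asym, D1 and NE2/3/4.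
-/

set_option autoImplicit false

open scoped BigOperators
open NormedSpace Finset

namespace Summit.QuantumFields.BalabanUV.T4Continuum.BlockAverageLoopFlux

open Literature.MathematicalPhysics.QuantumFieldTheory.Balaban1983to89
open B7Prop1Explicit

noncomputable section

variable {d : ℕ}

/-! ## §1 Coordinate truncations and the recursion of the tree contour -/

/-- `upper n v`: the vector `v` with its coordinates `j < n` set to `0` (the displacement of the tree contour
`Γ_{y,y+v}` of B5 (1.7) after its segments in the directions `d−1, …, n`). [folklore] -/
def upper (n : ℕ) (v : Site d) : Site d := fun j => if n ≤ (j : ℕ) then v j else 0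

/-- `upper 0 v = v`. [folklore] -/
@[simp] theorem upper_zero (v : Site d) : upper 0 v = v := by
  funext j; simp [upper]

/-- `upper n v = 0` once `n ≥ d`. [folklore] -/
theorem upper_of_le {n : ℕ} (hn : d ≤ n) (v : Site d) : upper n v = 0 := by
  funext j
  have : ¬ n ≤ (j : ℕ) := fun h => absurd (lt_of_lt_of_le j.isLt hn) (not_lt.mpr h)
  simp [upper, this]

/-- Coordinates `≥ n` are kept. [folklore] -/
theorem upper_apply_of_le {n : ℕ} (v : Site d) {j : Fin d} (h : n ≤ (j : ℕ)) : upper n v j = v j := by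
  simp [upper, h]

/-- Coordinates `< n` are zeroed. [folklore] -/
theorem upper_apply_of_lt {n : ℕ} (v : Site d) {j : Fin d} (h : (j : ℕ) < n) : upper n v j = 0 := by
  simp [upper, not_le.mpr h]

/-- `upper m v = upper (m+1) v + v_m e_m`. [folklore] -/
theorem upper_succ_add (m : Fin d) (v : Site d) : upper ((m : ℕ) + 1) v + v m • e m = upper m v := by
  funext j
  simp only [Pi.add_apply, Pi.smul_apply, e_apply, smul_eq_mul, mul_ite, mul_one, mul_zero]
  by_cases hjm : j = m
  · subst hjm
    rw [if_pos rfl, upper_apply_of_lt v (Nat.lt_succ_self _), upper_apply_of_le v le_rfl, zero_add]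
  · have hne : (j : ℕ) ≠ (m : ℕ) := fun h => hjm (Fin.ext h)
    rw [if_neg hjm, add_zero]
    rcases lt_or_gt_of_ne hne with h | h
    · rw [upper_apply_of_lt v h, upper_apply_of_lt v (Nat.lt_succ_of_lt h)]
    · rw [upper_apply_of_le v h.le, upper_apply_of_le v (Nat.succ_le_of_lt h)]

/-- `|upper n v|₁ ≤ |v|₁`. [folklore] -/
theorem l1_upper_le (n : ℕ) (v : Site d) : l1 (upper n v) ≤ l1 v := by
  unfold l1
  refine Finset.sum_le_sum fun j _ => ?_
  by_cases h : n ≤ (j : ℕ)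
  · rw [upper_apply_of_le v h]
  · rw [upper_apply_of_lt v (not_le.mp h)]; simp

/-- THE RECURSION OF THE TREE CONTOUR (B5 (1.7): the coordinates are changed in the order `d−1, …, 0`):
`Γ_{y, y + upper m v} = Γ_{y, y + upper (m+1) v} ∪ [segment of v_m steps in direction m]`. [folklore] -/
theorem treeWord_upper_succ (m : Fin d) (v : Site d) :
    treeWord (upper m v) = treeWord (upper ((m : ℕ) + 1) v) ++ seg m (v m) := by
  obtain ⟨s, t, hst⟩ := List.append_of_mem (a := m) (l := (List.finRange d).reverse) (by simp)
  have hpw : ((List.finRange d).reverse).Pairwise (fun a b => b < a) :=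
    List.pairwise_reverse.mpr (List.pairwise_lt_finRange d)
  rw [hst, List.pairwise_append, List.pairwise_cons] at hpw
  obtain ⟨-, ⟨ht, -⟩, hst'⟩ := hpw
  have hs : ∀ a ∈ s, (m : ℕ) < a := fun a ha => Fin.lt_def.mp (hst' a ha m (by simp))
  have ht' : ∀ b ∈ t, (b : ℕ) < m := fun b hb => Fin.lt_def.mp (ht b hb)
  unfold treeWord
  rw [hst]
  simp only [List.flatMap_append, List.flatMap_cons]
  have h1 : s.flatMap (fun κ => seg κ (upper m v κ)) = s.flatMap (fun κ => seg κ (upper ((m : ℕ) + 1) v κ)) :=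
    flatMap_congr_of fun κ hκ => by
      rw [upper_apply_of_le v (le_of_lt (hs κ hκ)), upper_apply_of_le v (Nat.succ_le_of_lt (hs κ hκ))]
  have h2 : ∀ n : ℕ, n ≤ (m : ℕ) + 1 → (m : ℕ) ≤ n → t.flatMap (fun κ => seg κ (upper n v κ)) = [] := by
    intro n hn _
    rw [List.flatMap_eq_nil_iff]
    intro κ hκ
    rw [upper_apply_of_lt v (lt_of_lt_of_le (ht' κ hκ) (by omega)), seg_zero]
  rw [h1, h2 m (Nat.le_succ _) le_rfl, h2 ((m : ℕ) + 1) le_rfl (Nat.le_succ _), upper_apply_of_le v le_rfl,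
    upper_apply_of_lt v (Nat.lt_succ_self _), seg_zero]
  simp

/-! ## §2 The loop-flux formula for the loops of (42) -/

section Loop

variable {𝔸 : Type*} [NormedRing 𝔸]

/-- `A(Γ_{y, y + upper m v}) = A(Γ_{y, y + upper (m+1) v}) + A([segment])`. [folklore] -/
theorem asum_treeWord_upper_succ (A : Site d → Fin d → 𝔸) (x : Site d) (m : Fin d) (v : Site d) :
    asum A x (treeWord (upper m v)) =
      asum A x (treeWord (upper ((m : ℕ) + 1) v)) + asum A (x + upper ((m : ℕ) + 1) v) (seg m (v m)) := by
  rw [treeWord_upper_succ, asum_append, disp_treeWord]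

/-- The circulation around the loop `Γ_{c,x} ∪ (−Γ_c)` of (42) (`c = ⟨q, q + Le_κ⟩`, `x = q + v`): tree part plus
straight part, `A(Γ_{q,x}) − A(Γ_{q+Le_κ, x+Le_κ}) + A([x, x + Le_κ]) − A([q, q + Le_κ])`. [folklore] -/
theorem asum_loop_eq (L : ℕ) (A : Site d → Fin d → 𝔸) (q : Site d) (κ : Fin d) (v : Site d) :
    asum A q (gammaWord L κ v ++ seg κ (-(L : ℤ))) =
      (asum A q (treeWord v) - asum A (q + (L : ℤ) • e κ) (treeWord v))
        + (asum A (q + v) (seg κ L) - asum A q (seg κ L)) := by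
  rw [asum_append, disp_gammaWord, asum_gammaWord, asum_seg_neg, add_sub_cancel_right]
  abel

/-- **THE LOOP-FLUX FORMULA, rectangle form.**  For `v ≥ 0` (coordinates `n_j`), the circulation of `A` around
`Γ_{c,x} ∪ (−Γ_c)` is the sum over the coordinate directions `m` of the circulations around the `n_m × L`
rectangles `R_m` in the `(m, κ)`-plane based at `q + upper (m+1) v` (telescoping along the order `d−1, …, 0` of the
tree contour; the `m = κ` rectangle is degenerate and contributes `0`). [folklore] -/
theorem asum_loop_telescope (L : ℕ) (A : Site d → Fin d → 𝔸) (q : Site d) (κ : Fin d) (n : Fin d → ℕ) :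
    asum A q (gammaWord L κ (fun j => (n j : ℤ)) ++ seg κ (-(L : ℤ))) =
      ∑ m : Fin d, asum A (q + upper ((m : ℕ) + 1) (fun j => (n j : ℤ))) (rectWord (n m) L m κ) := by
  set v : Site d := fun j => (n j : ℤ) with hv
  set G : ℕ → 𝔸 := fun k =>
    (asum A q (treeWord (upper k v)) - asum A (q + (L : ℤ) • e κ) (treeWord (upper k v)))
      + (asum A (q + upper k v) (seg κ L) - asum A q (seg κ L)) with hG
  have h0 : G 0 = asum A q (gammaWord L κ v ++ seg κ (-(L : ℤ))) := by
    rw [asum_loop_eq]; simp [hG]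
  have hd : G d = 0 := by
    simp [hG, upper_of_le le_rfl]
  have hstep : ∀ m : Fin d, G m - G ((m : ℕ) + 1) = asum A (q + upper ((m : ℕ) + 1) v) (rectWord (n m) L m κ) := by
    intro m
    have hvm : v m = ((n m : ℕ) : ℤ) := rfl
    simp only [hG]
    rw [asum_treeWord_upper_succ A q m v, asum_treeWord_upper_succ A (q + (L : ℤ) • e κ) m v,
      ← upper_succ_add m v, asum_rectWord, hvm,
      show q + (L : ℤ) • e κ + upper ((m : ℕ) + 1) v = q + upper ((m : ℕ) + 1) v + (L : ℤ) • e κ by abel,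
      show q + (upper ((m : ℕ) + 1) v + ((n m : ℕ) : ℤ) • e m) = q + upper ((m : ℕ) + 1) v + ((n m : ℕ) : ℤ) • e m by
        abel]
    abel
  have htel : ∑ m ∈ Finset.range d, (G m - G (m + 1)) = G 0 - G d := Finset.sum_range_sub' G d
  rw [← h0, ← sub_zero (G 0), ← hd, ← htel, ← Fin.sum_univ_eq_sum_range (fun k => G k - G (k + 1)) d]
  exact Finset.sum_congr rfl fun m _ => hstep m

/-- **THE LOOP-FLUX FORMULA, plaquette form** (abelian Stokes, tree `B7Prop1Explicit.stokes`): the circulation of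
`A` around `Γ_{c,x} ∪ (−Γ_c)`, `x = q + v`, `v ≥ 0`, is
`Σ_m Σ_{i<v_m} Σ_{j<L} A(∂p)_{q + upper(m+1)v + ie_m + je_κ}(plaqWord m κ)`. [folklore] -/
theorem asum_loop_eq_sum_plaq (L : ℕ) (A : Site d → Fin d → 𝔸) (q : Site d) (κ : Fin d) (n : Fin d → ℕ) :
    asum A q (gammaWord L κ (fun j => (n j : ℤ)) ++ seg κ (-(L : ℤ))) =
      ∑ m : Fin d, ∑ i ∈ Finset.range (n m), ∑ j ∈ Finset.range L,
        asum A (q + upper ((m : ℕ) + 1) (fun j => (n j : ℤ)) + (i : ℤ) • e m + (j : ℤ) • e κ) (plaqWord m κ) := by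
  rw [asum_loop_telescope]
  exact Finset.sum_congr rfl fun m _ => stokes A _ _ _ _ _

/-- A plaquette word with equal directions has zero circulation. [folklore] -/
theorem asum_plaqWord_self (A : Site d → Fin d → 𝔸) (p : Site d) (κ : Fin d) :
    asum A p (plaqWord κ κ) = 0 := by
  rw [asum_plaqWord]; abel

/-- Orientation: `A(∂p)(plaqWord ν κ) = −A(∂p)(plaqWord κ ν)`. [folklore] -/
theorem asum_plaqWord_swap (A : Site d → Fin d → 𝔸) (p : Site d) (κ ν : Fin d) :
    asum A p (plaqWord ν κ) = -asum A p (plaqWord κ ν) := by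
  rw [asum_plaqWord, asum_plaqWord]; abel

end Loop

/-! ## §3 Averaging over the corner block: `Σ_r r_m`, the constant-flux value `X₀` with its sign -/

/-- The reflection `r_m ↦ L − 1 − r_m` of the corner block in the coordinate `m`. [folklore] -/
def reflectAt (L : ℕ) (m : Fin d) (r : Fin d → Fin L) : Fin d → Fin L := Function.update r m (Fin.rev (r m))

/-- The reflection is an involution. [folklore] -/
theorem reflectAt_reflectAt (L : ℕ) (m : Fin d) (r : Fin d → Fin L) : reflectAt L m (reflectAt L m r) = r := by
  funext j
  unfold reflectAt
  by_cases h : j = m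
  · subst h; simp
  · simp [Function.update_of_ne h]

/-- `Σ_{r ∈ [0,L)^d} r_m = L^d (L − 1)/2` (as reals). [folklore] -/
theorem sum_boxCoord (L : ℕ) (m : Fin d) :
    ∑ r : Fin d → Fin L, ((r m : ℕ) : ℝ) = (L : ℝ) ^ d * (((L : ℝ) - 1) / 2) := by
  have hinv : Function.Involutive (reflectAt L m) := reflectAt_reflectAt (d := d) L m
  set σ : Equiv.Perm (Fin d → Fin L) := hinv.toPerm _ with hσ
  have hsum : ∑ r : Fin d → Fin L, ((r m : ℕ) : ℝ) = ∑ r : Fin d → Fin L, (((reflectAt L m r) m : ℕ) : ℝ) :=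
    (Equiv.sum_comp σ (fun r : Fin d → Fin L => ((r m : ℕ) : ℝ))).symm
  have hrefl : ∀ r : Fin d → Fin L, (((reflectAt L m r) m : ℕ) : ℝ) = (L : ℝ) - 1 - ((r m : ℕ) : ℝ) := by
    intro r
    simp only [reflectAt, Function.update_self, Fin.val_rev]
    have h := (r m).isLt
    rw [Nat.cast_sub (by omega), Nat.cast_add, Nat.cast_one]
    ring
  have hcard : ∑ _r : Fin d → Fin L, ((L : ℝ) - 1) = (L : ℝ) ^ d * (L - 1) := by
    rw [Finset.sum_const, Finset.card_univ, Fintype.card_fun, Fintype.card_fin, Fintype.card_fin, nsmul_eq_mul,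
      Nat.cast_pow]
  have h2 : ∑ r : Fin d → Fin L, ((r m : ℕ) : ℝ) + ∑ r : Fin d → Fin L, (((reflectAt L m r) m : ℕ) : ℝ)
      = (L : ℝ) ^ d * (L - 1) := by
    rw [← Finset.sum_add_distrib]
    simp_rw [hrefl, add_sub_cancel]
    exact hcard
  rw [← hsum] at h2
  linarith

section Avg

variable {𝔸 : Type*} [NormedRing 𝔸] [NormedAlgebra ℂ 𝔸]

/-- The averaging identity behind `X₀`: `Σ_r L^{−d} Σ_m Σ_{i<r_m} Σ_{j<L} g_m = (L(L−1)/2) • Σ_m g_m`. [folklore] -/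
theorem avg_tripleSum_const (L : ℕ) (hL : 1 ≤ L) (g : Fin d → 𝔸) :
    ∑ r : Fin d → Fin L, ((L : ℝ) ^ d)⁻¹ •
        ∑ m : Fin d, ∑ _i ∈ Finset.range (r m : ℕ), ∑ _j ∈ Finset.range L, g m
      = (((L : ℝ) * (L - 1)) / 2) • ∑ m : Fin d, g m := by
  have hL0 : ((L : ℝ)) ^ d ≠ 0 := pow_ne_zero _ (by exact_mod_cast (by omega : L ≠ 0))
  have hinner : ∀ r : Fin d → Fin L,
      ((L : ℝ) ^ d)⁻¹ • ∑ m : Fin d, ∑ _i ∈ Finset.range (r m : ℕ), ∑ _j ∈ Finset.range L, g m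
        = ∑ m : Fin d, (((L : ℝ) ^ d)⁻¹ * ((r m : ℕ) : ℝ) * L) • g m := by
    intro r
    rw [Finset.smul_sum]
    refine Finset.sum_congr rfl fun m _ => ?_
    rw [Finset.sum_const, Finset.card_range, Finset.sum_const, Finset.card_range, ← Nat.cast_smul_eq_nsmul ℝ,
      ← Nat.cast_smul_eq_nsmul ℝ, smul_smul, smul_smul]
  rw [Finset.sum_congr rfl (fun r _ => hinner r), Finset.sum_comm, Finset.smul_sum]
  refine Finset.sum_congr rfl fun m _ => ?_
  rw [← Finset.sum_smul]
  congr 1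
  rw [← Finset.sum_mul, ← Finset.mul_sum, sum_boxCoord L m, inv_mul_cancel_left₀ hL0]
  ring

/-- **`X₀` WITH ITS SIGN.**  If the plaquette circulations of `A` in the `(m, κ)`-planes do not depend on the base
point, `A(∂p)_p(plaqWord m κ) = f_m` (so necessarily `f_κ = 0`), then the first-order exponent of (42) is
`X̂_c = (L(L−1)/2) • Σ_m f_m` (`f_κ = 0` by `asum_plaqWord_self`; sign: `plaqWord m κ = [+e_m, +e_κ, −e_m, −e_κ]`, so
`X̂_c = −(L(L−1)/2) Σ_{m≠κ} F_{κm}/L²`-type in the `(κ, m)` orientation, `asum_plaqWord_swap`). [folklore] -/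
theorem Xhat_of_const_flux (L : ℕ) (hL : 1 ≤ L) (A : Site d → Fin d → 𝔸) (q : Site d) (κ : Fin d)
    (f : Fin d → 𝔸) (hf : ∀ (p : Site d) (m : Fin d), asum A p (plaqWord m κ) = f m) :
    Xhat L A q κ = (((L : ℝ) * (L - 1)) / 2) • ∑ m : Fin d, f m := by
  have hX : Xhat L A q κ = ∑ r : Fin d → Fin L, ((L : ℝ) ^ d)⁻¹ •
      ∑ m : Fin d, ∑ _i ∈ Finset.range (r m : ℕ), ∑ _j ∈ Finset.range L, f m := by
    unfold Xhat
    refine Finset.sum_congr rfl fun r _ => ?_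
    rw [show boxVec L r = fun j => ((fun j => (r j : ℕ)) j : ℤ) from rfl, asum_loop_eq_sum_plaq]
    simp only [hf]
  rw [hX, avg_tripleSum_const L hL]

/-- **THE LOOP-FLUX FORMULA for `X̂_c`**: `Xhat L A q κ = Σ_r L^{−d} Σ_m Σ_{i<r_m} Σ_{j<L}
A(∂p)_{q + upper(m+1)r + ie_m + je_κ}(plaqWord m κ)`. [folklore] -/
theorem Xhat_eq_sum_plaq (L : ℕ) (A : Site d → Fin d → 𝔸) (q : Site d) (κ : Fin d) :
    Xhat L A q κ = ∑ r : Fin d → Fin L, ((L : ℝ) ^ d)⁻¹ •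
      ∑ m : Fin d, ∑ i ∈ Finset.range (r m : ℕ), ∑ j ∈ Finset.range L,
        asum A (q + upper ((m : ℕ) + 1) (boxVec L r) + (i : ℤ) • e m + (j : ℤ) • e κ) (plaqWord m κ) := by
  unfold Xhat
  refine Finset.sum_congr rfl fun r _ => ?_
  rw [show boxVec L r = fun j => ((fun j => (r j : ℕ)) j : ℤ) from rfl, asum_loop_eq_sum_plaq]

/-! ## §4 Lipschitz flux: the deviation of `X̂_c` from its constant-flux value -/

/-- The base points met in the loop-flux formula lie within `|·|₁`-distance `(d+2)L` of `q`. [folklore] -/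
theorem l1_loopPoint_le (L : ℕ) (r : Fin d → Fin L) (m κ : Fin d) {i j : ℕ} (hi : i < (r m : ℕ)) (hj : j < L) :
    l1 (upper ((m : ℕ) + 1) (boxVec L r) + (i : ℤ) • e m + (j : ℤ) • e κ) ≤ (d + 2) * L := by
  have h1 : l1 (upper ((m : ℕ) + 1) (boxVec L r)) ≤ d * L := (l1_upper_le _ _).trans (l1_boxVec_le L r)
  have h2 := l1_add_le (upper ((m : ℕ) + 1) (boxVec L r) + (i : ℤ) • e m) ((j : ℤ) • e κ)
  have h3 := l1_add_le (upper ((m : ℕ) + 1) (boxVec L r)) ((i : ℤ) • e m)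
  rw [l1_zsmul_e, Int.natAbs_natCast] at h2 h3
  have hi' : i ≤ L := by have := (r m).isLt; omega
  nlinarith

/-- **DEVIATION FOR A LIPSCHITZ FLUX** (the abelian «loop-log prediction»): if the plaquette circulations are
`δ`-Lipschitz in the base point (in `|·|₁`, within distance `(d+2)L` of `q`), then
`‖X̂_c − (L(L−1)/2) • Σ_m A(∂p)_q(plaqWord m κ)‖ ≤ (d(d+2)/2)·L³·δ`. [folklore] -/
theorem norm_Xhat_sub_const_flux_le (L : ℕ) (hL : 1 ≤ L) (A : Site d → Fin d → 𝔸) (q : Site d) (κ : Fin d)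
    {δ : ℝ} (hδ0 : 0 ≤ δ)
    (hδ : ∀ (p : Site d) (m : Fin d), l1 (p - q) ≤ (d + 2) * L →
      ‖asum A p (plaqWord m κ) - asum A q (plaqWord m κ)‖ ≤ δ * l1 (p - q)) :
    ‖Xhat L A q κ - (((L : ℝ) * (L - 1)) / 2) • ∑ m : Fin d, asum A q (plaqWord m κ)‖
      ≤ d * (d + 2) / 2 * (L : ℝ) ^ 3 * δ := by
  have hL0 : (0 : ℝ) < (L : ℝ) ^ d := pow_pos (by exact_mod_cast (by omega : 0 < L)) _
  have hLr : (1 : ℝ) ≤ L := by exact_mod_cast hL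
  rw [Xhat_eq_sum_plaq, ← avg_tripleSum_const L hL (fun m => asum A q (plaqWord m κ)), ← Finset.sum_sub_distrib]
  simp_rw [← smul_sub, ← Finset.sum_sub_distrib]
  -- pointwise bound of each difference by δ (d+2) L
  have hterm : ∀ (r : Fin d → Fin L) (m : Fin d), ∀ i ∈ Finset.range (r m : ℕ), ∀ j ∈ Finset.range L,
      ‖asum A (q + upper ((m : ℕ) + 1) (boxVec L r) + (i : ℤ) • e m + (j : ℤ) • e κ) (plaqWord m κ)
          - asum A q (plaqWord m κ)‖ ≤ δ * ((d + 2) * L) := by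
    intro r m i hi j hj
    rw [Finset.mem_range] at hi hj
    have hl := l1_loopPoint_le L r m κ hi hj
    have hp := hδ (q + upper ((m : ℕ) + 1) (boxVec L r) + (i : ℤ) • e m + (j : ℤ) • e κ) m
      (by rw [show q + upper ((m : ℕ) + 1) (boxVec L r) + (i : ℤ) • e m + (j : ℤ) • e κ - q
            = upper ((m : ℕ) + 1) (boxVec L r) + (i : ℤ) • e m + (j : ℤ) • e κ by abel]; exact hl)
    rw [show q + upper ((m : ℕ) + 1) (boxVec L r) + (i : ℤ) • e m + (j : ℤ) • e κ - q
          = upper ((m : ℕ) + 1) (boxVec L r) + (i : ℤ) • e m + (j : ℤ) • e κ by abel] at hp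
    refine hp.trans ?_
    have : (l1 (upper ((m : ℕ) + 1) (boxVec L r) + (i : ℤ) • e m + (j : ℤ) • e κ) : ℝ) ≤ (d + 2) * L := by
      exact_mod_cast hl
    exact mul_le_mul_of_nonneg_left this hδ0
  -- sum the bounds
  calc ‖∑ r : Fin d → Fin L, ((L : ℝ) ^ d)⁻¹ • ∑ m : Fin d, ∑ i ∈ Finset.range (r m : ℕ), ∑ j ∈ Finset.range L,
          (asum A (q + upper ((m : ℕ) + 1) (boxVec L r) + (i : ℤ) • e m + (j : ℤ) • e κ) (plaqWord m κ)
            - asum A q (plaqWord m κ))‖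
      ≤ ∑ r : Fin d → Fin L, ((L : ℝ) ^ d)⁻¹ * ∑ m : Fin d, ∑ _i ∈ Finset.range (r m : ℕ), ∑ _j ∈ Finset.range L,
          δ * ((d + 2) * L) := by
        refine (norm_sum_le _ _).trans (Finset.sum_le_sum fun r _ => ?_)
        rw [norm_smul, Real.norm_of_nonneg (inv_nonneg.mpr hL0.le)]
        refine mul_le_mul_of_nonneg_left ?_ (inv_nonneg.mpr hL0.le)
        refine (norm_sum_le _ _).trans (Finset.sum_le_sum fun m _ => ?_)
        refine (norm_sum_le _ _).trans (Finset.sum_le_sum fun i hi => ?_)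
        exact (norm_sum_le _ _).trans (Finset.sum_le_sum fun j hj => hterm r m i hi j hj)
    _ = d * (d + 2) / 2 * ((L : ℝ) ^ 2 * (L - 1)) * δ := by
        have hinner : ∀ r : Fin d → Fin L,
            ((L : ℝ) ^ d)⁻¹ * ∑ m : Fin d, ∑ _i ∈ Finset.range (r m : ℕ), ∑ _j ∈ Finset.range L, δ * ((d + 2) * L)
              = ∑ m : Fin d, ((L : ℝ) ^ d)⁻¹ * (r m : ℕ) * (L * (δ * ((d + 2) * L))) := by
          intro r
          rw [Finset.mul_sum]
          refine Finset.sum_congr rfl fun m _ => ?_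
          rw [Finset.sum_const, Finset.card_range, Finset.sum_const, Finset.card_range, smul_smul, nsmul_eq_mul,
            Nat.cast_mul]
          ring
        have hm : ∀ m : Fin d, ∑ r : Fin d → Fin L, ((L : ℝ) ^ d)⁻¹ * (r m : ℕ) * (L * (δ * ((d + 2) * L)))
            = (L - 1) / 2 * (L * (δ * ((d + 2) * L))) := by
          intro m
          rw [← Finset.sum_mul, ← Finset.mul_sum, sum_boxCoord L m, inv_mul_cancel_left₀ (ne_of_gt hL0)]
        rw [Finset.sum_congr rfl (fun r _ => hinner r), Finset.sum_comm, Finset.sum_congr rfl (fun m _ => hm m),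
          Finset.sum_const, Finset.card_univ, Fintype.card_fin, nsmul_eq_mul]
        ring
    _ ≤ d * (d + 2) / 2 * (L : ℝ) ^ 3 * δ := by
        have h1 : (L : ℝ) ^ 2 * (L - 1) ≤ (L : ℝ) ^ 3 := by nlinarith
        have h2 : (0 : ℝ) ≤ d * (d + 2) / 2 := by positivity
        nlinarith [mul_nonneg h2 hδ0]

end Avg

end

end Summit.QuantumFields.BalabanUV.T4Continuum.BlockAverageLoopFlux
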